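import Mathlib.MeasureTheory.Measure.Lebesgue.EqHaar
import Mathlib.MeasureTheory.Measure.Haar.InnerProductSpace
import Mathlib.Analysis.InnerProductSpace.PiL2
import HarnessLib

/-!
# Volume of the intersection of a ball with a spherical shell in `ℝ³`

Analysis/FluidPDE support file (a counting tool for the Whitney-ball chaining argument in the
proof of the nonlinear estimate `Y₆` of Tao 2011, §10, arXiv:1108.1165 p. 33: "If one fixes a
large ball `Bⱼ`, one easily checks that `Σ_{i: a(i)=j} rᵢ⁴ ≲ rⱼ⁴`" — the descendants of a ball live
in thin spherical layers of the annulus, whose volume inside a ball of radius `R` we bound here).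

Main statement (`volume_ball_inter_shell_le`): for every centre `x₀`, every ball `B(p, R)`,
`R > 0`, and radii `0 ≤ α ≤ β`,

  `vol (B(p, R) ∩ {α ≤ |y − x₀| ≤ β}) ≤ 600 R² (β − α) · vol B(0, 1)`.

So a spherical layer of thickness `τ` meets a ball of radius `R` in volume `O(R²τ)`, uniformly in
the radius of the layer. Proof, avoiding polar coordinates: if `|p − x₀| ≤ 3R` the set lies in the
layer `{α ≤ |y − x₀| ≤ min(β, 4R)}` of volume `(4π/3)(β'³ − α³) ≤ 48R²(β − α) vol B(0,1)`; if
`|p − x₀| > 3R` the ball lies in the narrow cone `{x : |x − ⟨x,e⟩e| ≤ t⟨x,e⟩}` around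
`e = (p − x₀)/|p − x₀|` with `t = R/(|p − x₀| − R) ≤ 1/2`, whose unit truncation is covered by
`⌈1/t⌉ + 1` balls of radius `2t` (volume `≤ 16t² vol B(0,1)`), and by the scaling of Lebesgue
measure the cone meets `{α' ≤ |x| < β'}` in volume `(β'³ − α'³) · vol(unit truncation)`.

## Mathlib search

Mathlib has the volume of balls and the scaling of additive Haar measure
(`Measure.addHaar_ball`, `Measure.addHaar_closedBall`, `Measure.addHaar_smul_of_nonneg`) and polar
coordinates only as an abstract measure-preserving equivalence
(`Measure.measurePreserving_homeomorphUnitSphereProd`); no estimate of ball–shell intersections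
(`lean search 'shell|ball_inter'`: nothing relevant).

## References

* T. Tao, *Localisation and compactness properties of the Navier–Stokes global regularity
  problem*, Anal. PDE 6 (2013) = arXiv:1108.1165, §10, p. 33.
-/

noncomputable section

open MeasureTheory Set Filter Metric Function Module
open scoped ENNReal NNReal Topology RealInnerProductSpace Pointwise

namespace Literature.Analysis.FluidPDE

namespace ShellBallVolume

/-- Local notation for physical space `ℝ³ = EuclideanSpace ℝ (Fin 3)`. -/
local notation "ℝ³" => EuclideanSpace ℝ (Fin 3)

/-! ### The narrow cone `{x : |x − ⟨x,e⟩e| ≤ t ⟨x,e⟩}` -/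

/-- Membership in the cone is invariant under positive dilations. [folklore] -/
theorem cone_smul_mem_iff (e x : ℝ³) (t : ℝ) {c : ℝ} (hc : 0 < c) :
    ‖c • x - ⟪c • x, e⟫ • e‖ ≤ t * ⟪c • x, e⟫ ↔ ‖x - ⟪x, e⟫ • e‖ ≤ t * ⟪x, e⟫ := by
  rw [real_inner_smul_left, ← smul_smul, ← smul_sub, norm_smul, Real.norm_of_nonneg hc.le,
    mul_left_comm]
  exact mul_le_mul_iff_right₀ hc

/-- The cone is a closed, hence measurable, set. [folklore] -/
theorem measurableSet_cone (e : ℝ³) (t : ℝ) :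
    MeasurableSet {x : ℝ³ | ‖x - ⟪x, e⟫ • e‖ ≤ t * ⟪x, e⟫} := by
  have hc : Continuous fun x : ℝ³ => ‖x - ⟪x, e⟫ • e‖ - t * ⟪x, e⟫ := by fun_prop
  have : {x : ℝ³ | ‖x - ⟪x, e⟫ • e‖ ≤ t * ⟪x, e⟫} =
      (fun x : ℝ³ => ‖x - ⟪x, e⟫ • e‖ - t * ⟪x, e⟫) ⁻¹' Iic 0 := by
    ext x; simp
  rw [this]
  exact hc.measurable measurableSet_Iic

/-- The layer `{α ≤ |x| < β}` is measurable. [folklore] -/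
theorem measurableSet_layer (α β : ℝ) : MeasurableSet {x : ℝ³ | α ≤ ‖x‖ ∧ ‖x‖ < β} :=
  (isClosed_le continuous_const continuous_norm).measurableSet.inter
    (isOpen_lt continuous_norm continuous_const).measurableSet

/-- **Scaling of the truncated cone**: `B(0, s) ∩ cone = s · (B(0, 1) ∩ cone)` for `s > 0`. [folklore] -/
theorem ball_inter_cone_eq_smul (e : ℝ³) (t : ℝ) {s : ℝ} (hs : 0 < s) :
    ball (0 : ℝ³) s ∩ {x | ‖x - ⟪x, e⟫ • e‖ ≤ t * ⟪x, e⟫} =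
      s • (ball (0 : ℝ³) 1 ∩ {x | ‖x - ⟪x, e⟫ • e‖ ≤ t * ⟪x, e⟫}) := by
  ext x
  rw [Set.mem_smul_set_iff_inv_smul_mem₀ hs.ne', mem_inter_iff, mem_inter_iff, mem_ball_zero_iff,
    mem_ball_zero_iff, mem_setOf_eq, mem_setOf_eq, norm_smul, norm_inv, Real.norm_of_nonneg hs.le,
    cone_smul_mem_iff e x t (inv_pos.2 hs), inv_mul_lt_iff₀ hs, mul_one]

/-- Volume of the truncated cone at scale `s ≥ 0`: `vol(B(0,s) ∩ cone) = s³ vol(B(0,1) ∩ cone)`. [folklore] -/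
theorem volume_ball_inter_cone (e : ℝ³) (t : ℝ) {s : ℝ} (hs : 0 ≤ s) :
    volume (ball (0 : ℝ³) s ∩ {x | ‖x - ⟪x, e⟫ • e‖ ≤ t * ⟪x, e⟫}) =
      ENNReal.ofReal (s ^ 3) * volume (ball (0 : ℝ³) 1 ∩ {x | ‖x - ⟪x, e⟫ • e‖ ≤ t * ⟪x, e⟫}) := by
  rcases hs.eq_or_lt with h | h
  · rw [← h]; simp
  · rw [ball_inter_cone_eq_smul e t h, Measure.addHaar_smul_of_nonneg volume h.le,
      finrank_euclideanSpace_fin]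

/-- **Covering the unit truncated cone by small balls**: for a unit vector `e` and
`0 < t ≤ 1/2`, `B(0,1) ∩ cone ⊆ ⋃_{m ≤ ⌈1/t⌉} B((m/⌈1/t⌉) e, 2t)`. [folklore] -/
theorem ball_inter_cone_subset_iUnion {e : ℝ³} (he : ‖e‖ = 1) {t : ℝ} (ht0 : 0 < t) (ht : t ≤ 2⁻¹) :
    ball (0 : ℝ³) 1 ∩ {x | ‖x - ⟪x, e⟫ • e‖ ≤ t * ⟪x, e⟫} ⊆
      ⋃ m ∈ Finset.range (⌈t⁻¹⌉₊ + 1), ball (((m : ℝ) / ⌈t⁻¹⌉₊) • e) (2 * t) := by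
  intro x hx
  obtain ⟨hx1, hx2⟩ := hx
  rw [mem_ball_zero_iff] at hx1
  rw [mem_setOf_eq] at hx2
  set σ : ℝ := ⟪x, e⟫ with hσ
  set M : ℕ := ⌈t⁻¹⌉₊ with hM
  have hσ0 : 0 ≤ σ := by
    have h : 0 ≤ t * σ := (norm_nonneg _).trans hx2
    nlinarith
  have hσ1 : σ < 1 := by
    calc σ ≤ ‖x‖ * ‖e‖ := real_inner_le_norm x e
      _ = ‖x‖ := by rw [he, mul_one]
      _ < 1 := hx1
  have hMt : t⁻¹ ≤ M := Nat.le_ceil _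
  have ht2 : (2 : ℝ) ≤ t⁻¹ := by rw [le_inv_comm₀ two_pos ht0]; exact ht
  have hMpos : (0 : ℝ) < M := lt_of_lt_of_le (by linarith) hMt
  have hMne : (M : ℝ) ≠ 0 := hMpos.ne'
  set m : ℕ := ⌊σ * M⌋₊ with hm
  have hm1 : (m : ℝ) ≤ σ * M := Nat.floor_le (by positivity)
  have hm2 : σ * M < m + 1 := Nat.lt_floor_add_one _
  rw [mem_iUnion₂]
  refine ⟨m, ?_, ?_⟩
  · rw [Finset.mem_range]
    have : (m : ℝ) < M + 1 := by
      calc (m : ℝ) ≤ σ * M := hm1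
        _ ≤ 1 * M := by gcongr
        _ < M + 1 := by linarith
    exact_mod_cast this
  · rw [mem_ball, dist_eq_norm]
    have hdiff : |σ - (m : ℝ) / M| ≤ t := by
      rw [abs_le]
      constructor
      · have : (m : ℝ) / M ≤ σ := by rw [div_le_iff₀ hMpos]; exact hm1
        linarith
      · have h1 : σ < ((m : ℝ) + 1) / M := by rw [lt_div_iff₀ hMpos]; exact hm2
        have h2 : ((m : ℝ) + 1) / M = (m : ℝ) / M + (M : ℝ)⁻¹ := by field_simp
        have h3 : (M : ℝ)⁻¹ ≤ t := by
          rw [inv_le_comm₀ hMpos ht0]; exact hMt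
        linarith
    calc ‖x - ((m : ℝ) / M) • e‖ = ‖(x - σ • e) + (σ - (m : ℝ) / M) • e‖ := by
          congr 1; rw [sub_smul]; abel
      _ ≤ ‖x - σ • e‖ + ‖(σ - (m : ℝ) / M) • e‖ := norm_add_le _ _
      _ = ‖x - σ • e‖ + |σ - (m : ℝ) / M| := by rw [norm_smul, Real.norm_eq_abs, he, mul_one]
      _ ≤ t * σ + t := add_le_add hx2 hdiff
      _ < t * 1 + t := by gcongr
      _ = 2 * t := by ring

/-- **Volume of the unit truncated cone**: `vol(B(0,1) ∩ cone) ≤ 16 t² vol B(0,1)` for a unit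
vector `e` and `0 < t ≤ 1/2`. [folklore] -/
theorem volume_ball_inter_cone_le {e : ℝ³} (he : ‖e‖ = 1) {t : ℝ} (ht0 : 0 < t) (ht : t ≤ 2⁻¹) :
    volume (ball (0 : ℝ³) 1 ∩ {x | ‖x - ⟪x, e⟫ • e‖ ≤ t * ⟪x, e⟫}) ≤
      ENNReal.ofReal (16 * t ^ 2) * volume (ball (0 : ℝ³) 1) := by
  set M : ℕ := ⌈t⁻¹⌉₊ with hM
  have hMt : t⁻¹ ≤ M := Nat.le_ceil _
  have hM1 : (M : ℝ) < t⁻¹ + 1 := Nat.ceil_lt_add_one (inv_nonneg.2 ht0.le)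
  calc volume (ball (0 : ℝ³) 1 ∩ {x | ‖x - ⟪x, e⟫ • e‖ ≤ t * ⟪x, e⟫})
      ≤ volume (⋃ m ∈ Finset.range (M + 1), ball (((m : ℝ) / M) • e) (2 * t)) :=
        measure_mono (ball_inter_cone_subset_iUnion he ht0 ht)
    _ ≤ ∑ m ∈ Finset.range (M + 1), volume (ball (((m : ℝ) / M) • e) (2 * t)) :=
        measure_biUnion_finset_le _ _
    _ = ∑ _m ∈ Finset.range (M + 1), ENNReal.ofReal ((2 * t) ^ 3) * volume (ball (0 : ℝ³) 1) := by
        refine Finset.sum_congr rfl fun m _ => ?_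
        rw [Measure.addHaar_ball volume _ (by positivity), finrank_euclideanSpace_fin]
    _ = ((M + 1 : ℕ) : ℝ≥0∞) * (ENNReal.ofReal ((2 * t) ^ 3) * volume (ball (0 : ℝ³) 1)) := by
        rw [Finset.sum_const, Finset.card_range, nsmul_eq_mul]
    _ = ENNReal.ofReal (((M : ℝ) + 1) * (2 * t) ^ 3) * volume (ball (0 : ℝ³) 1) := by
        rw [← mul_assoc, ENNReal.ofReal_mul (by positivity)]
        congr 2
        rw [show ((M : ℝ) + 1) = ((M + 1 : ℕ) : ℝ) by push_cast; ring, ENNReal.ofReal_natCast]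
    _ ≤ ENNReal.ofReal (16 * t ^ 2) * volume (ball (0 : ℝ³) 1) := by
        refine mul_le_mul_left (ENNReal.ofReal_le_ofReal ?_) _
        have h1 : ((M : ℝ) + 1) * t ≤ 1 + 2 * t := by
          have : (M : ℝ) * t < (t⁻¹ + 1) * t := mul_lt_mul_of_pos_right hM1 ht0
          rw [add_mul, inv_mul_cancel₀ ht0.ne', one_mul] at this
          linarith
        have h2 : 0 ≤ (M : ℝ) + 1 := by positivity
        calc ((M : ℝ) + 1) * (2 * t) ^ 3 = 8 * t ^ 2 * (((M : ℝ) + 1) * t) := by ring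
          _ ≤ 8 * t ^ 2 * (1 + 2 * t) := by gcongr
          _ ≤ 8 * t ^ 2 * 2 := by gcongr; linarith
          _ = 16 * t ^ 2 := by ring

/-- **Volume of a layer of the cone**: for a unit vector `e`, `0 < t ≤ 1/2` and `0 ≤ α ≤ β`,
`vol(cone ∩ {α ≤ |x| < β}) ≤ 16 t² (β³ − α³) vol B(0,1)` (difference of two truncations and the
scaling of Lebesgue measure). [folklore] -/
theorem volume_cone_inter_shell_le {e : ℝ³} (he : ‖e‖ = 1) {t : ℝ} (ht0 : 0 < t) (ht : t ≤ 2⁻¹)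
    {α β : ℝ} (hα : 0 ≤ α) (hαβ : α ≤ β) :
    volume ({x : ℝ³ | ‖x - ⟪x, e⟫ • e‖ ≤ t * ⟪x, e⟫} ∩ {x | α ≤ ‖x‖ ∧ ‖x‖ < β}) ≤
      ENNReal.ofReal (16 * t ^ 2 * (β ^ 3 - α ^ 3)) * volume (ball (0 : ℝ³) 1) := by
  set K : Set ℝ³ := {x | ‖x - ⟪x, e⟫ • e‖ ≤ t * ⟪x, e⟫} with hK
  set V : ℝ≥0∞ := volume (ball (0 : ℝ³) 1 ∩ K) with hV
  have hβ : 0 ≤ β := hα.trans hαβ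
  have hA : volume (ball (0 : ℝ³) α ∩ K) = ENNReal.ofReal (α ^ 3) * V := volume_ball_inter_cone e t hα
  have hB : volume (ball (0 : ℝ³) β ∩ K) = ENNReal.ofReal (β ^ 3) * V := volume_ball_inter_cone e t hβ
  have hVtop : V ≠ ⊤ := (lt_of_le_of_lt (measure_mono inter_subset_left) measure_ball_lt_top).ne
  have hKm : MeasurableSet K := measurableSet_cone e t
  have hsub : K ∩ {x | α ≤ ‖x‖ ∧ ‖x‖ < β} ⊆ (ball (0 : ℝ³) β ∩ K) \ (ball (0 : ℝ³) α ∩ K) := by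
    rintro x ⟨hxK, hxα, hxβ⟩
    refine ⟨⟨mem_ball_zero_iff.2 hxβ, hxK⟩, fun h => ?_⟩
    have := mem_ball_zero_iff.1 h.1
    linarith
  have hnest : ball (0 : ℝ³) α ∩ K ⊆ ball (0 : ℝ³) β ∩ K :=
    inter_subset_inter_left _ (ball_subset_ball hαβ)
  have hAfin : volume (ball (0 : ℝ³) α ∩ K) ≠ ⊤ :=
    (lt_of_le_of_lt (measure_mono inter_subset_left) measure_ball_lt_top).ne
  calc volume (K ∩ {x | α ≤ ‖x‖ ∧ ‖x‖ < β})
      ≤ volume ((ball (0 : ℝ³) β ∩ K) \ (ball (0 : ℝ³) α ∩ K)) := measure_mono hsub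
    _ = volume (ball (0 : ℝ³) β ∩ K) - volume (ball (0 : ℝ³) α ∩ K) :=
        measure_sdiff hnest (measurableSet_ball.inter hKm).nullMeasurableSet hAfin
    _ = (ENNReal.ofReal (β ^ 3) - ENNReal.ofReal (α ^ 3)) * V := by rw [hA, hB, ENNReal.sub_mul fun _ _ => hVtop]
    _ = ENNReal.ofReal (β ^ 3 - α ^ 3) * V := by rw [ENNReal.ofReal_sub _ (by positivity)]
    _ ≤ ENNReal.ofReal (β ^ 3 - α ^ 3) * (ENNReal.ofReal (16 * t ^ 2) * volume (ball (0 : ℝ³) 1)) := by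
        gcongr; exact volume_ball_inter_cone_le he ht0 ht
    _ = ENNReal.ofReal (16 * t ^ 2 * (β ^ 3 - α ^ 3)) * volume (ball (0 : ℝ³) 1) := by
        rw [← mul_assoc, ← ENNReal.ofReal_mul (by nlinarith [pow_le_pow_left₀ hα hαβ 3]), mul_comm (β ^ 3 - α ^ 3)]

/-! ### Balls far from the centre lie in a narrow cone -/

/-- A ball `B(p, R)` with `|p − x₀| = D > R` lies, seen from `x₀`, in the cone of aperture
`t = R/(D − R)` around `e = (p − x₀)/D`, and in the layer `D − R < |y − x₀| < D + R`. [folklore] -/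
theorem sub_mem_cone_of_mem_ball {x₀ p y : ℝ³} {R : ℝ} (hR : 0 < R) (hD : R < ‖p - x₀‖)
    (hy : y ∈ ball p R) :
    ‖(y - x₀) - ⟪y - x₀, ‖p - x₀‖⁻¹ • (p - x₀)⟫ • (‖p - x₀‖⁻¹ • (p - x₀))‖ ≤
        R / (‖p - x₀‖ - R) * ⟪y - x₀, ‖p - x₀‖⁻¹ • (p - x₀)⟫ ∧
      ‖p - x₀‖ - R < ‖y - x₀‖ ∧ ‖y - x₀‖ < ‖p - x₀‖ + R := by
  set D : ℝ := ‖p - x₀‖ with hDdef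
  set e : ℝ³ := D⁻¹ • (p - x₀) with hedef
  set w : ℝ³ := y - p with hw
  have hD0 : 0 < D := hR.trans hD
  have hw1 : ‖w‖ < R := by rwa [hw, ← dist_eq_norm, ← mem_ball]
  have he : ‖e‖ = 1 := by
    rw [hedef, norm_smul, norm_inv, Real.norm_of_nonneg hD0.le, inv_mul_cancel₀ hD0.ne']
  have hpe : p - x₀ = D • e := by
    rw [hedef, smul_smul, mul_inv_cancel₀ hD0.ne', one_smul]
  have hv : y - x₀ = D • e + w := by rw [hw, ← hpe]; abel
  have hee : ⟪e, e⟫ = 1 := by rw [real_inner_self_eq_norm_sq, he, one_pow]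
  have hinner : ⟪y - x₀, e⟫ = D + ⟪w, e⟫ := by
    rw [hv, inner_add_left, real_inner_smul_left, hee, mul_one]
  have hwe : |⟪w, e⟫| ≤ ‖w‖ := by
    have := abs_real_inner_le_norm w e; rwa [he, mul_one] at this
  have hwe' := abs_le.1 hwe
  refine ⟨?_, ?_, ?_⟩
  · -- the orthogonal component is that of `w`
    have horth : (y - x₀) - ⟪y - x₀, e⟫ • e = w - ⟪w, e⟫ • e := by
      rw [hinner, hv, add_smul]; abel
    rw [horth]
    have h1 : ‖w - ⟪w, e⟫ • e‖ ≤ ‖w‖ := by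
      -- Pythagoras: `‖w‖² = ‖w - ⟨w,e⟩e‖² + ⟨w,e⟩²`
      have hsq : ‖w - ⟪w, e⟫ • e‖ ^ 2 = ‖w‖ ^ 2 - ⟪w, e⟫ ^ 2 := by
        rw [@norm_sub_sq_real, real_inner_smul_right, norm_smul, Real.norm_eq_abs, he, mul_one,
          sq_abs]
        ring
      nlinarith [norm_nonneg (w - ⟪w, e⟫ • e), norm_nonneg w, sq_nonneg ⟪w, e⟫]
    have h2 : ‖w‖ ≤ R / (D - R) * (D + ⟪w, e⟫) := by
      rw [div_mul_eq_mul_div, le_div_iff₀ (by linarith)]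
      nlinarith [hwe'.1]
    rw [hinner]
    exact h1.trans h2
  · calc D - R < D - ‖w‖ := by linarith
      _ ≤ ‖y - x₀‖ := by
          rw [hv]
          have := norm_sub_norm_le (D • e) (-w)
          rw [norm_neg, sub_neg_eq_add, norm_smul, Real.norm_of_nonneg hD0.le, he, mul_one] at this
          linarith
  · calc ‖y - x₀‖ = ‖D • e + w‖ := by rw [hv]
      _ ≤ ‖D • e‖ + ‖w‖ := norm_add_le _ _
      _ = D + ‖w‖ := by rw [norm_smul, Real.norm_of_nonneg hD0.le, he, mul_one]
      _ < D + R := by linarith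

/-! ### The ball–shell estimate -/

/-- Elementary: `b³ − a³ ≤ 3b²(b − a)` for `0 ≤ a ≤ b`. [folklore] -/
theorem cube_sub_cube_le {a b : ℝ} (ha : 0 ≤ a) (hab : a ≤ b) : b ^ 3 - a ^ 3 ≤ 3 * b ^ 2 * (b - a) := by
  nlinarith [mul_nonneg ha (sub_nonneg.2 hab), mul_nonneg (mul_nonneg ha ha) (sub_nonneg.2 hab),
    sq_nonneg (b - a)]

/-- **Volume of a ball intersected with a spherical shell.** For every `x₀, p ∈ ℝ³`, `R > 0` and
`0 ≤ α ≤ β`: `vol (B(p, R) ∩ {α ≤ |y − x₀| ≤ β}) ≤ 600 R² (β − α) vol B(0,1)` — a layer of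
thickness `β − α` meets a ball of radius `R` in volume `O(R²(β − α))`, uniformly in the radius of
the layer (the counting device behind "`Σ_{i : a(i) = j} rᵢ⁴ ≲ rⱼ⁴`" in Tao's Whitney chaining). [folklore] -/
theorem volume_ball_inter_shell_le (x₀ p : ℝ³) {R : ℝ} (hR : 0 < R) {α β : ℝ} (hα : 0 ≤ α)
    (hαβ : α ≤ β) :
    volume (ball p R ∩ {y | α ≤ ‖y - x₀‖ ∧ ‖y - x₀‖ ≤ β}) ≤
      ENNReal.ofReal (600 * R ^ 2 * (β - α)) * volume (ball (0 : ℝ³) 1) := by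
  set D : ℝ := ‖p - x₀‖ with hDdef
  have hV : volume (ball (0 : ℝ³) 1) ≠ ⊤ := measure_ball_lt_top.ne
  rcases le_or_gt D (3 * R) with hnear | hfar
  · -- near case: the set lies in the layer `α ≤ |y - x₀| ≤ min β (4R)` around `x₀`
    set β₁ : ℝ := min β (4 * R) with hβ₁
    rcases le_or_gt α β₁ with hαβ₁ | hαβ₁
    · have hsub : ball p R ∩ {y | α ≤ ‖y - x₀‖ ∧ ‖y - x₀‖ ≤ β} ⊆
          closedBall x₀ β₁ \ ball x₀ α := by
        rintro y ⟨hy, hyα, hyβ⟩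
        have hy4 : ‖y - x₀‖ ≤ 4 * R := by
          have h1 : ‖y - x₀‖ ≤ ‖y - p‖ + ‖p - x₀‖ := norm_sub_le_norm_sub_add_norm_sub _ _ _
          have h2 : ‖y - p‖ < R := by rwa [← dist_eq_norm, ← mem_ball]
          linarith
        refine ⟨?_, fun h => ?_⟩
        · rw [mem_closedBall, dist_eq_norm]; exact le_min hyβ hy4
        · rw [mem_ball, dist_eq_norm] at h; linarith
      calc volume (ball p R ∩ {y | α ≤ ‖y - x₀‖ ∧ ‖y - x₀‖ ≤ β})
          ≤ volume (closedBall x₀ β₁ \ ball x₀ α) := measure_mono hsub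
        _ = volume (closedBall x₀ β₁) - volume (ball x₀ α) :=
            measure_sdiff (ball_subset_closedBall.trans (closedBall_subset_closedBall hαβ₁))
              measurableSet_ball.nullMeasurableSet measure_ball_lt_top.ne
        _ = (ENNReal.ofReal (β₁ ^ 3) - ENNReal.ofReal (α ^ 3)) * volume (ball (0 : ℝ³) 1) := by
            rw [Measure.addHaar_closedBall volume _ (hα.trans hαβ₁), Measure.addHaar_ball volume _ hα,
              finrank_euclideanSpace_fin, ENNReal.sub_mul fun _ _ => hV]
        _ = ENNReal.ofReal (β₁ ^ 3 - α ^ 3) * volume (ball (0 : ℝ³) 1) := by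
            rw [ENNReal.ofReal_sub _ (by positivity)]
        _ ≤ ENNReal.ofReal (600 * R ^ 2 * (β - α)) * volume (ball (0 : ℝ³) 1) := by
            refine mul_le_mul_left (ENNReal.ofReal_le_ofReal ?_) _
            have h1 := cube_sub_cube_le hα hαβ₁
            have h2 : β₁ ≤ 4 * R := min_le_right _ _
            have h3 : β₁ - α ≤ β - α := sub_le_sub_right (min_le_left _ _) _
            have h4 : 0 ≤ β₁ := hα.trans hαβ₁
            have h5 : 0 ≤ β₁ - α := sub_nonneg.2 hαβ₁
            have e1 : 3 * β₁ ^ 2 * (β₁ - α) ≤ 3 * (4 * R) ^ 2 * (β - α) := by gcongr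
            nlinarith [mul_nonneg (sq_nonneg R) (sub_nonneg.2 hαβ)]
    · -- empty intersection
      have hempty : ball p R ∩ {y | α ≤ ‖y - x₀‖ ∧ ‖y - x₀‖ ≤ β} = ∅ := by
        ext y
        simp only [mem_inter_iff, mem_ball, mem_setOf_eq, mem_empty_iff_false, iff_false, not_and,
          not_le]
        intro hy hyα
        have h1 : ‖y - x₀‖ ≤ ‖y - p‖ + ‖p - x₀‖ := norm_sub_le_norm_sub_add_norm_sub _ _ _
        rw [dist_eq_norm] at hy
        have : β₁ < ‖y - x₀‖ := lt_of_lt_of_le hαβ₁ hyα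
        rw [hβ₁, min_lt_iff] at this
        rcases this with h | h
        · exact h
        · linarith
      rw [hempty, measure_empty]
      exact zero_le
  · -- far case: the ball lies in a narrow cone around `e = (p - x₀)/D`
    have hRD : R < D := by linarith
    have hD0 : 0 < D := hR.trans hRD
    -- trivial bound when the layer is thick: `vol ≤ vol B(p,R) = R³ vol B(0,1) ≤ R²(β-α) vol B(0,1)`
    rcases le_or_gt R (β - α) with hthick | hthin
    · calc volume (ball p R ∩ {y | α ≤ ‖y - x₀‖ ∧ ‖y - x₀‖ ≤ β}) ≤ volume (ball p R) :=
            measure_mono inter_subset_left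
        _ = ENNReal.ofReal (R ^ 3) * volume (ball (0 : ℝ³) 1) := by
            rw [Measure.addHaar_ball volume _ hR.le, finrank_euclideanSpace_fin]
        _ ≤ ENNReal.ofReal (600 * R ^ 2 * (β - α)) * volume (ball (0 : ℝ³) 1) := by
            refine mul_le_mul_left (ENNReal.ofReal_le_ofReal ?_) _
            nlinarith [sq_nonneg R, mul_nonneg (sq_nonneg R) (sub_nonneg.2 hthick)]
    -- degenerate layer: a sphere, of measure zero
    rcases hαβ.eq_or_lt with hαβe | hαβs
    · have hsub : ball p R ∩ {y | α ≤ ‖y - x₀‖ ∧ ‖y - x₀‖ ≤ β} ⊆ sphere x₀ α := by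
        rintro y ⟨-, hyα, hyβ⟩
        rw [mem_sphere, dist_eq_norm]
        rw [← hαβe] at hyβ
        exact le_antisymm hyβ hyα
      calc volume (ball p R ∩ {y | α ≤ ‖y - x₀‖ ∧ ‖y - x₀‖ ≤ β}) ≤ volume (sphere x₀ α) :=
            measure_mono hsub
        _ = 0 := Measure.addHaar_sphere volume x₀ α
        _ ≤ _ := zero_le
    set e : ℝ³ := D⁻¹ • (p - x₀) with hedef
    have he : ‖e‖ = 1 := by
      rw [hedef, norm_smul, norm_inv, Real.norm_of_nonneg hD0.le, inv_mul_cancel₀ hD0.ne']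
    set t : ℝ := R / (D - R) with htdef
    have ht0 : 0 < t := div_pos hR (by linarith)
    have ht : t ≤ 2⁻¹ := by
      rw [htdef, div_le_iff₀ (by linarith)]; linarith
    have htD : t * (D - R) = R := by rw [htdef, div_mul_cancel₀ _ (by linarith)]
    set α₁ : ℝ := max α (D - R) with hα₁
    set β₁ : ℝ := min β (D + R) with hβ₁
    set β' : ℝ := β₁ + (β - α) with hβ'
    have hα₁0 : 0 ≤ α₁ := hα.trans (le_max_left _ _)
    rcases le_or_gt α₁ β₁ with hαβ₁ | hαβ₁
    · have hα₁β' : α₁ ≤ β' := by rw [hβ']; linarith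
      have hsub : ball p R ∩ {y | α ≤ ‖y - x₀‖ ∧ ‖y - x₀‖ ≤ β} ⊆
          (fun y : ℝ³ => y - x₀) ⁻¹' ({x : ℝ³ | ‖x - ⟪x, e⟫ • e‖ ≤ t * ⟪x, e⟫} ∩
            {x | α₁ ≤ ‖x‖ ∧ ‖x‖ < β'}) := by
        rintro y ⟨hy, hyα, hyβ⟩
        obtain ⟨hcone, hlo, hhi⟩ := sub_mem_cone_of_mem_ball hR hRD hy
        refine ⟨hcone, max_le hyα hlo.le, ?_⟩
        have : ‖y - x₀‖ ≤ β₁ := le_min hyβ hhi.le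
        show ‖y - x₀‖ < β'
        rw [hβ']; linarith
      have hmp : MeasurePreserving (fun y : ℝ³ => y - x₀) volume volume :=
        measurePreserving_sub_right volume x₀
      have hmeas : MeasurableSet ({x : ℝ³ | ‖x - ⟪x, e⟫ • e‖ ≤ t * ⟪x, e⟫} ∩
          {x | α₁ ≤ ‖x‖ ∧ ‖x‖ < β'}) := (measurableSet_cone e t).inter (measurableSet_layer _ _)
      calc volume (ball p R ∩ {y | α ≤ ‖y - x₀‖ ∧ ‖y - x₀‖ ≤ β})
          ≤ volume ((fun y : ℝ³ => y - x₀) ⁻¹' ({x : ℝ³ | ‖x - ⟪x, e⟫ • e‖ ≤ t * ⟪x, e⟫} ∩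
              {x | α₁ ≤ ‖x‖ ∧ ‖x‖ < β'})) := measure_mono hsub
        _ = volume ({x : ℝ³ | ‖x - ⟪x, e⟫ • e‖ ≤ t * ⟪x, e⟫} ∩ {x | α₁ ≤ ‖x‖ ∧ ‖x‖ < β'}) :=
            hmp.measure_preimage hmeas.nullMeasurableSet
        _ ≤ ENNReal.ofReal (16 * t ^ 2 * (β' ^ 3 - α₁ ^ 3)) * volume (ball (0 : ℝ³) 1) :=
            volume_cone_inter_shell_le he ht0 ht hα₁0 hα₁β'
        _ ≤ ENNReal.ofReal (600 * R ^ 2 * (β - α)) * volume (ball (0 : ℝ³) 1) := by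
            refine mul_le_mul_left (ENNReal.ofReal_le_ofReal ?_) _
            -- `16 t² (β'³ - α₁³) ≤ 48 (t β')² (β' - α₁)`, `t β' ≤ 5R/2`, `β' - α₁ ≤ 2(β - α)`
            have hβ'0 : 0 ≤ β' := hα₁0.trans hα₁β'
            have h1 := cube_sub_cube_le hα₁0 hα₁β'
            have hβ'α : β' - α₁ ≤ 2 * (β - α) := by
              have : β₁ - α₁ ≤ β - α := sub_le_sub (min_le_left _ _) (le_max_left _ _)
              rw [hβ']; linarith
            have htβ' : t * β' ≤ 5 / 2 * R := by
              have hβ'le : β' ≤ (D + R) + (β - α) := by rw [hβ']; linarith [min_le_right β (D + R)]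
              have hDR : D + R ≤ 2 * (D - R) := by linarith
              calc t * β' ≤ t * ((D + R) + (β - α)) := by gcongr
                _ ≤ t * (2 * (D - R) + R) := mul_le_mul_of_nonneg_left (by linarith) ht0.le
                _ = 2 * (t * (D - R)) + t * R := by ring
                _ ≤ 2 * R + 2⁻¹ * R := by rw [htD]; gcongr
                _ = 5 / 2 * R := by ring
            have hba : 0 ≤ β - α := sub_nonneg.2 hαβ
            have htb0 : 0 ≤ t * β' := by positivity
            have hβ'α0 : 0 ≤ β' - α₁ := sub_nonneg.2 hα₁β'
            have e1 : 16 * t ^ 2 * (β' ^ 3 - α₁ ^ 3) ≤ 48 * (t * β') ^ 2 * (β' - α₁) :=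
              calc 16 * t ^ 2 * (β' ^ 3 - α₁ ^ 3) ≤ 16 * t ^ 2 * (3 * β' ^ 2 * (β' - α₁)) := by
                    gcongr
                _ = 48 * (t * β') ^ 2 * (β' - α₁) := by ring
            have e2 : 48 * (t * β') ^ 2 * (β' - α₁) ≤ 48 * (5 / 2 * R) ^ 2 * (2 * (β - α)) := by
              gcongr
            linarith
    · have hempty : ball p R ∩ {y | α ≤ ‖y - x₀‖ ∧ ‖y - x₀‖ ≤ β} = ∅ := by
        ext y
        simp only [mem_inter_iff, mem_setOf_eq, mem_empty_iff_false, iff_false, not_and, not_le]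
        intro hy hyα
        obtain ⟨-, hlo, hhi⟩ := sub_mem_cone_of_mem_ball hR hRD hy
        have h1 : α₁ ≤ ‖y - x₀‖ := max_le hyα hlo.le
        by_contra h
        rw [not_lt] at h
        have h2 : ‖y - x₀‖ ≤ β₁ := le_min h hhi.le
        linarith
      rw [hempty, measure_empty]
      exact zero_le

end ShellBallVolume

end Literature.Analysis.FluidPDE

end
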